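import Mathlib
import HarnessLib.Audit
import Summits.PneNP.PneNP.Theorems.PstarGateU2Joins
import Summits.PneNP.PneNP.Theorems.PstarGateCasePNorHolders

/-!
# One GATED chord, node N5, branch (A): a CONS-T companion pair coupled to the gated cycle through `u` violates expansion (E2; prover-1 g19)

FRONTIER range-avoidance ladder, rung F-N3 (`stmt-PneNP-19007`), cell `pnp-ideate` (`PstarGateNodesX.GateU2X`); restricted-model proof complexity —
nothing here bears on `P` versus `NP`.

Branch (A) of `PstarGateU2Corner.u2_corner_cases` (`D e' = {j₁, j₂}` a CONS-T pair with literals `σ ∈ j₁`, `τ ∈ j₂` realised together by an output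
`g` — a join edge or a private-free pendant) under the EQ coupling of `PstarGateU2Coupling.u2_coupling` (every edge of `D e ∆ D e'` passes through
`u`).  By `PstarGateU2Joins.u2_no_bridge` every other tree edge is a CROSS edge (both AND variables among those of `j₁, j₂`).  Boundary count on
`X = J₀ ∪ {g₀, g}`: every tree edge pays at most ONE boundary variable (`σ`/`τ` held by `g`, `u` held by `g₀`, a cross edge's slots held by
`j₁, j₂`), `e` one, `e'` and `g₀` two each, a pendant realiser two: `(r, 3/2)`-expansion forces `#(J₀ ∖ N) ≤ 2`, i.e. `J₀ ∖ N = D e'`, so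
`D e ⊆ D e'`, `D e = D e'`, `e = e'`:

* `u2_branchA_false` — **branch (A) with EQ coupling is contradictory.**
-/

set_option linter.dupNamespace false -- `Summit.PneNP.PneNP.…`: summit = sub-problem name (D-0017 single-conjunct layout)

open Finset Literature.Computability.Complexity
open scoped symmDiff
open Summit.PneNP.PneNP.Theorems.PstarTyped (Typed)
open Summit.PneNP.PneNP.Theorems.PstarSALevel (varSet bdry BoundaryExpanding SimpleOverlap)
open Summit.PneNP.PneNP.Theorems.PstarGapLinearised (andPair andPair_subset_varSet)
open Summit.PneNP.PneNP.Theorems.PstarChordEndgameTools (mem_andPair_iff)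
open Summit.PneNP.PneNP.Theorems.PstarCentreFree (vars_mem_varSet)
open Summit.PneNP.PneNP.Theorems.PstarXCore (xverts)
open Summit.PneNP.PneNP.Theorems.PstarCoreBound (XorClosed)
open Summit.PneNP.PneNP.Theorems.PstarReadSumset (V2)
open Summit.PneNP.PneNP.Theorems.PstarChordSystem (ChordSystem)
open Summit.PneNP.PneNP.Theorems.PstarChordBridgeTools (privs coef xpdeg)
open Summit.PneNP.PneNP.Theorems.PstarChordBridge (BridgeData sys Solution Lift)
open Summit.PneNP.PneNP.Theorems.PstarChordBridgeForcing (gam freeMon)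
open Summit.PneNP.PneNP.Theorems.PstarChordBridgeFundamental (two_le_card_of_even eq_of_fundamental_eq)
open Summit.PneNP.PneNP.Theorems.PstarNorCoreTools (not_mem_bdry_of_two card_varSet_inter_bdry_le card_bdry_le_sum)
open Summit.PneNP.PneNP.Theorems.PstarGateBridge (GateHyp)
open Summit.PneNP.PneNP.Theorems.PstarGateCasePNorHolders (not_mem_bdry_of_closed card_three_slots)
open Summit.PneNP.PneNP.Theorems.PstarGateNodes (GateData)
open Summit.PneNP.PneNP.Theorems.PstarGateNodesX (GateDataX)
open Summit.PneNP.PneNP.Theorems.PstarGateU2Joins (u2_no_bridge)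

namespace Summit.PneNP.PneNP.Theorems.PstarGateU2BranchA

variable {n m : ℕ}

/-- **Branch (A) with EQ coupling is contradictory.**  See the module docstring. -/
theorem u2_branchA_false (I : LocalMap 4 n m) (hI : I.IsPure xorAndPred) (hT : Typed I) (hS : SimpleOverlap I) {r₀ : ℕ}
    (hB : BoundaryExpanding r₀ I) {B : BridgeData n m} {e g₀ : Fin m} {u : Fin n} {κ₀ : ZMod 2} (hD : GateDataX I r₀ B e g₀ u κ₀)
    {e' : Fin m} (hN : B.N = {e, e'}) (hne : e' ≠ e)
    (hU2 : ∀ a, (sys I B).ρ e' a ≠ 0 ∧ (sys I B).ρ' e' a ≠ 0 ∧ (sys I B).ρ e' a ≠ (sys I B).ρ' e' a)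
    {j₁ j₂ g : Fin m} {σ τ : Fin n} (h12 : j₁ ≠ j₂) (hDe' : B.D e' = {j₁, j₂}) (hdisj : Disjoint (andPair I j₁) (andPair I j₂))
    (hσ : σ ∈ andPair I j₁) (hτ : τ ∈ andPair I j₂)
    (hg : g ∈ B.T₁ ∪ freeMon I (B.N.erase e) (B.G₁.erase g₀) ∪ (B.T₂ ∪ freeMon I (B.N.erase e) B.G₂)) (hσg : σ ∈ andPair I g)
    (hτg : τ ∈ andPair I g)
    (hM : ∀ j ∈ B.D e ∆ B.D e', I.vars j 2 = u ∨ I.vars j 3 = u) : False := by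
  classical
  obtain ⟨hXc, hW, hr, hd₁, hd₂, hL, hPe, -, hG, hg₀, hgv, hju, hup, hux, hG₁p, hcoef, hT3, hM0⟩ := id hD
  have he : e ∈ B.N := hG.1
  have he' : e' ∈ B.N := by rw [hN]; exact mem_insert_of_mem (mem_singleton_self _)
  have heJ : e ∈ B.J₀ := hW.hN he
  have he'J : e' ∈ B.J₀ := hW.hN he'
  have hg₀J : g₀ ∉ B.J₀ := fun h => disjoint_left.1 hd₁ hg₀ h
  set F := B.J₀ \ B.N with hFdef
  have hFJ : F ⊆ B.J₀ := sdiff_subset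
  have hDe'F : B.D e' ⊆ F := hW.hD e' he'
  have hj₁F : j₁ ∈ F := hDe'F (by rw [hDe']; exact mem_insert_self _ _)
  have hj₂F : j₂ ∈ F := hDe'F (by rw [hDe']; exact mem_insert_of_mem (mem_singleton_self _))
  have hστ : σ ≠ τ := fun h => disjoint_left.1 hdisj hσ (h ▸ hτ)
  -- the realiser lies in the radius, is not `g₀`, `e`, `e'`, `j₁`, `j₂`
  have hgcases : g ∈ B.T₁ ∨ g ∈ freeMon I (B.N.erase e) (B.G₁.erase g₀) ∨ g ∈ B.T₂ ∨ g ∈ freeMon I (B.N.erase e) B.G₂ := by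
    rcases mem_union.1 hg with h | h <;> rcases mem_union.1 h with h' | h'
    · exact Or.inl h'
    · exact Or.inr (Or.inl h')
    · exact Or.inr (Or.inr (Or.inl h'))
    · exact Or.inr (Or.inr (Or.inr h'))
  have hgR : g ∈ B.J₀ ∪ B.G₁ ∪ B.G₂ := by
    rcases hgcases with h | h | h | h
    · exact mem_union_left _ (mem_union_left _ (hFJ (hW.hT₁ h)))
    · exact mem_union_left _ (mem_union_right _ (mem_of_mem_erase (mem_filter.1 h).1))
    · exact mem_union_left _ (mem_union_left _ (hFJ (hW.hT₂ h)))
    · exact mem_union_right _ (mem_filter.1 h).1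
  have hgJ_or : g ∈ F ∨ g ∉ B.J₀ := by
    rcases hgcases with h | h | h | h
    · exact Or.inl (hW.hT₁ h)
    · exact Or.inr fun h' => disjoint_left.1 hd₁ (mem_of_mem_erase (mem_filter.1 h).1) h'
    · exact Or.inl (hW.hT₂ h)
    · exact Or.inr fun h' => disjoint_left.1 hd₂ (mem_filter.1 h).1 h'
  have hgN : g ∉ B.N := by
    rcases hgJ_or with h | h
    · exact (mem_sdiff.1 h).2
    · exact fun h' => h (hW.hN h')
  have hge : g ≠ e := fun h => hgN (h ▸ he)
  have hge' : g ≠ e' := fun h => hgN (h ▸ he')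
  have hgg₀ : g ≠ g₀ := by
    rcases hgcases with h | h | h | h
    · exact fun h' => hg₀J (h' ▸ hFJ (hW.hT₁ h))
    · exact ne_of_mem_erase (mem_filter.1 h).1
    · exact fun h' => hg₀J (h' ▸ hFJ (hW.hT₂ h))
    · intro h'
      obtain ⟨-, -, hG₂p, -⟩ := hG
      have h2 := hG₂p g (mem_filter.1 h).1
      rw [h'] at h2
      rcases hgv with ⟨h3, -⟩ | ⟨-, h3⟩
      · exact h2.1 h3
      · exact h2.2 h3
  have hgj₁ : g ≠ j₁ := fun h => disjoint_left.1 hdisj (h ▸ hτg) hτ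
  have hgj₂ : g ≠ j₂ := fun h => disjoint_left.1 hdisj hσ (h ▸ hσg)
  -- the family `X = J₀ + g₀ + g`
  set X : Finset (Fin m) := insert g (insert g₀ B.J₀) with hXdef
  have hJX : B.J₀ ⊆ X := (subset_insert _ _).trans (subset_insert _ _)
  have hg₀X : g₀ ∈ X := mem_insert_of_mem (mem_insert_self _ _)
  have hgX : g ∈ X := mem_insert_self _ _
  have hXR : X ⊆ B.J₀ ∪ B.G₁ ∪ B.G₂ :=
    insert_subset hgR (insert_subset (mem_union_left _ (mem_union_right _ hg₀)) (subset_union_left.trans subset_union_left))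
  have hXr : X.card ≤ r₀ := (card_le_card hXR).trans hr
  -- a tree edge through `u`
  obtain ⟨jᵤ, hjᵤF, hjᵤu⟩ := hju
  have hu_jᵤ : u ∈ varSet I jᵤ := by rcases hjᵤu with h | h <;> rw [h] <;> exact vars_mem_varSet I jᵤ _
  have hp_g₀ : I.vars e 2 ∈ varSet I g₀ := by
    rcases hgv with ⟨h2, -⟩ | ⟨-, h3⟩
    · exact h2 ▸ vars_mem_varSet I g₀ 2
    · exact h3 ▸ vars_mem_varSet I g₀ 3
  -- every tree edge outside `D e'` passes through `u` or is a cross edge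
  have htree : ∀ k ∈ F, k ∉ B.D e' → ∃ s : Fin 4, 2 ≤ s.val ∧ ∃ k' ∈ X, k' ≠ k ∧ I.vars k s ∈ varSet I k' := by
    intro k hk hkD'
    by_cases hkD : k ∈ B.D e
    · have hksd : k ∈ B.D e ∆ B.D e' := Finset.mem_symmDiff.2 (Or.inl ⟨hkD, hkD'⟩)
      have hkg₀ : g₀ ≠ k := fun h => hg₀J (h ▸ hFJ hk)
      rcases hM k hksd with h | h
      · exact ⟨2, by decide, g₀, hg₀X, hkg₀, by rw [h]; rcases hgv with ⟨-, h3⟩ | ⟨h2, -⟩; exact h3 ▸ vars_mem_varSet I g₀ 3; exact h2 ▸ vars_mem_varSet I g₀ 2⟩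
      · exact ⟨3, by decide, g₀, hg₀X, hkg₀, by rw [h]; rcases hgv with ⟨-, h3⟩ | ⟨h2, -⟩; exact h3 ▸ vars_mem_varSet I g₀ 3; exact h2 ▸ vars_mem_varSet I g₀ 2⟩
    · -- a bridge: both AND variables among those of `j₁, j₂`
      have hcross : ¬ (I.vars k 2 ∉ (B.D e').biUnion (andPair I) ∨ I.vars k 3 ∉ (B.D e').biUnion (andPair I)) :=
        fun h => u2_no_bridge I hI hT hS hB hD hN hne hU2 hk hkD hkD' h
      push Not at hcross
      obtain ⟨h2, -⟩ := hcross
      obtain ⟨j', hj', hv⟩ := mem_biUnion.1 h2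
      exact ⟨2, by decide, j', hJX (hFJ (hDe'F hj')), fun h => hkD' (h ▸ hj'), andPair_subset_varSet I j' hv⟩
  -- per-output budgets
  let q : Fin m → ℕ := fun k => if k = g₀ then 2 else if k = e' then 2 else if k ∈ B.J₀ then 1 else 2
  have hq : ∀ k ∈ X, (varSet I k ∩ bdry I X).card ≤ q k := by
    intro k hk
    by_cases hkg₀ : k = g₀
    · subst hkg₀
      simp only [q, if_true]
      have h := card_varSet_inter_bdry_le I X k {2, 3} (fun s hs => by
        simp only [mem_insert, mem_singleton] at hs
        rcases hs with rfl | rfl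
        · rcases hgv with ⟨h2, -⟩ | ⟨h2, -⟩
          · exact not_mem_bdry_of_two I hk (hJX heJ) (fun h => hg₀J (h ▸ heJ)) (vars_mem_varSet I k 2) (h2 ▸ vars_mem_varSet I e 2)
          · exact not_mem_bdry_of_two I hk (hJX (hFJ hjᵤF)) (fun h => hg₀J (h ▸ hFJ hjᵤF)) (vars_mem_varSet I k 2) (h2 ▸ hu_jᵤ)
        · rcases hgv with ⟨-, h3⟩ | ⟨-, h3⟩
          · exact not_mem_bdry_of_two I hk (hJX (hFJ hjᵤF)) (fun h => hg₀J (h ▸ hFJ hjᵤF)) (vars_mem_varSet I k 3) (h3 ▸ hu_jᵤ)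
          · exact not_mem_bdry_of_two I hk (hJX heJ) (fun h => hg₀J (h ▸ heJ)) (vars_mem_varSet I k 3) (h3 ▸ vars_mem_varSet I e 2))
      have h2 : ({2, 3} : Finset (Fin 4)).card = 2 := by decide
      rw [h2] at h; exact h
    by_cases hke' : k = e'
    · subst hke'
      simp only [q, if_neg hkg₀, if_true]
      have h := card_varSet_inter_bdry_le I X k {0, 1} (fun s hs => by
        simp only [mem_insert, mem_singleton] at hs
        rcases hs with rfl | rfl
        · exact not_mem_bdry_of_closed I hXc hJX he'J (by decide)
        · exact not_mem_bdry_of_closed I hXc hJX he'J (by decide))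
      have h2 : ({0, 1} : Finset (Fin 4)).card = 2 := by decide
      rw [h2] at h; exact h
    by_cases hkJ : k ∈ B.J₀
    · simp only [q, if_neg hkg₀, if_neg hke', if_pos hkJ]
      -- a core output other than `e'`: XOR slots inner, plus one AND slot held elsewhere
      obtain ⟨s, hs2, k', hk', hne', hv⟩ : ∃ s : Fin 4, 2 ≤ s.val ∧ ∃ k' ∈ X, k' ≠ k ∧ I.vars k s ∈ varSet I k' := by
        by_cases hke : k = e
        · subst hke
          exact ⟨2, by decide, g₀, hg₀X, fun h => hg₀J (h ▸ heJ), hp_g₀⟩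
        have hkF : k ∈ F := by
          refine mem_sdiff.2 ⟨hkJ, fun hkN => ?_⟩
          rw [hN, mem_insert, mem_singleton] at hkN
          rcases hkN with h | h
          · exact hke h
          · exact hke' h
        by_cases hkD' : k ∈ B.D e'
        · -- `j₁` or `j₂`: its literal is held by the realiser
          rw [hDe', mem_insert, mem_singleton] at hkD'
          rcases hkD' with rfl | rfl
          · rcases (mem_andPair_iff I k σ).1 hσ with h | h
            · exact ⟨2, by decide, g, hgX, hgj₁, h ▸ andPair_subset_varSet I g hσg⟩
            · exact ⟨3, by decide, g, hgX, hgj₁, h ▸ andPair_subset_varSet I g hσg⟩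
          · rcases (mem_andPair_iff I k τ).1 hτ with h | h
            · exact ⟨2, by decide, g, hgX, hgj₂, h ▸ andPair_subset_varSet I g hτg⟩
            · exact ⟨3, by decide, g, hgX, hgj₂, h ▸ andPair_subset_varSet I g hτg⟩
        · exact htree k hkF hkD'
      have h := card_varSet_inter_bdry_le I X k {0, 1, s} (fun s' hs' => by
        simp only [mem_insert, mem_singleton] at hs'
        rcases hs' with rfl | rfl | rfl
        · exact not_mem_bdry_of_closed I hXc hJX hkJ (by decide)
        · exact not_mem_bdry_of_closed I hXc hJX hkJ (by decide)
        · exact not_mem_bdry_of_two I hk hk' (Ne.symm hne') (vars_mem_varSet I k s') hv)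
      rw [card_three_slots hs2] at h
      exact h
    · -- the pendant realiser `g ∉ J₀`: both AND slots held by `j₁`, `j₂`
      simp only [q, if_neg hkg₀, if_neg hke', if_neg hkJ]
      have hkg : k = g := by
        rw [hXdef, mem_insert, mem_insert] at hk
        rcases hk with h | h | h
        · exact h
        · exact absurd h hkg₀
        · exact absurd h hkJ
      subst hkg
      have hslots : ∀ s : Fin 4, 2 ≤ s.val → ∃ k' ∈ X, k' ≠ k ∧ I.vars k s ∈ varSet I k' := by
        intro s hs
        have hs23 : s = 2 ∨ s = 3 := by
          rcases s with ⟨s, h4⟩; simp only [Fin.ext_iff]; simp only at hs; omega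
        have hval : I.vars k s = σ ∨ I.vars k s = τ := by
          rcases (mem_andPair_iff I k σ).1 hσg with h1 | h1 <;> rcases (mem_andPair_iff I k τ).1 hτg with h2 | h2
          · exact absurd (h1.trans h2.symm) hστ
          · rcases hs23 with rfl | rfl
            · exact Or.inl h1.symm
            · exact Or.inr h2.symm
          · rcases hs23 with rfl | rfl
            · exact Or.inr h2.symm
            · exact Or.inl h1.symm
          · exact absurd (h1.trans h2.symm) hστ
        rcases hval with h | h
        · exact ⟨j₁, hJX (hFJ hj₁F), (Ne.symm hgj₁), h ▸ andPair_subset_varSet I j₁ hσ⟩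
        · exact ⟨j₂, hJX (hFJ hj₂F), (Ne.symm hgj₂), h ▸ andPair_subset_varSet I j₂ hτ⟩
      have h := card_varSet_inter_bdry_le I X k {2, 3} (fun s hs => by
        simp only [mem_insert, mem_singleton] at hs
        have hs2 : 2 ≤ s.val := by rcases hs with rfl | rfl <;> decide
        obtain ⟨k', hk'X, hne', hv⟩ := hslots s hs2
        exact not_mem_bdry_of_two I hk hk'X (Ne.symm hne') (vars_mem_varSet I k s) hv)
      have h2 : ({2, 3} : Finset (Fin 4)).card = 2 := by decide
      rw [h2] at h; exact h
  have hbd := card_bdry_le_sum I X q hq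
  -- evaluate the sum: `q = 2` on `g₀`, on `e'`, on `g ∉ J₀`; `1` on the rest of `J₀`
  have hg₀X' : g₀ ∉ B.J₀ := hg₀J
  have hne'g₀ : e' ≠ g₀ := fun h => hg₀J (h ▸ he'J)
  have hqe' : q e' = 2 := by
    show (if e' = g₀ then 2 else if e' = e' then 2 else if e' ∈ B.J₀ then 1 else 2) = 2
    rw [if_neg hne'g₀, if_pos rfl]
  have hqg₀ : q g₀ = 2 := by
    show (if g₀ = g₀ then 2 else if g₀ = e' then 2 else if g₀ ∈ B.J₀ then 1 else 2) = 2
    rw [if_pos rfl]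
  have hsumJ : ∑ k ∈ B.J₀, q k = B.J₀.card + 1 := by
    have hsplit := (add_sum_erase B.J₀ q he'J).symm
    have hrest : ∑ k ∈ B.J₀.erase e', q k = (B.J₀.erase e').card := by
      rw [card_eq_sum_ones]
      refine sum_congr rfl fun k hk => ?_
      have hk' := mem_of_mem_erase hk
      have hkg₀ : k ≠ g₀ := fun h => hg₀J (h ▸ hk')
      have hke' : k ≠ e' := ne_of_mem_erase hk
      show (if k = g₀ then 2 else if k = e' then 2 else if k ∈ B.J₀ then 1 else 2) = 1
      rw [if_neg hkg₀, if_neg hke', if_pos hk']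
    rw [hsplit, hrest, card_erase_of_mem he'J, hqe']
    have := card_pos.2 ⟨e', he'J⟩
    omega
  have hFcard : B.J₀.card = F.card + 2 := by
    have h : F.card + B.N.card = B.J₀.card := card_sdiff_add_card_eq_card hW.hN
    have hNcard : B.N.card = 2 := by rw [hN, card_pair (Ne.symm hne)]
    omega
  have h2F : 2 ≤ F.card := by
    have := card_le_card hDe'F
    rw [hDe', card_pair h12] at this
    exact this
  -- the two cases for the realiser
  rcases hgJ_or with hgF | hgout
  · -- `g` is a join edge: `X = J₀ + g₀`
    have hXeq : X = insert g₀ B.J₀ := by rw [hXdef, insert_eq_of_mem (mem_insert_of_mem (hFJ hgF))]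
    have hXcard : X.card = B.J₀.card + 1 := by rw [hXeq, card_insert_of_notMem hg₀J]
    have hsumX : ∑ k ∈ X, q k = 2 + (B.J₀.card + 1) := by
      rw [hXeq, sum_insert hg₀J, hsumJ, hqg₀]
    have hexp := hB X hXr
    rw [hXcard] at hexp
    rw [hsumX] at hbd
    omega
  · -- `g` is a pendant: `X = J₀ + g₀ + g`
    have hg_ins : g ∉ insert g₀ B.J₀ := by
      rw [mem_insert, not_or]; exact ⟨hgg₀, hgout⟩
    have hXcard : X.card = B.J₀.card + 2 := by rw [hXdef, card_insert_of_notMem hg_ins, card_insert_of_notMem hg₀J]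
    have hqg : q g = 2 := by
      show (if g = g₀ then 2 else if g = e' then 2 else if g ∈ B.J₀ then 1 else 2) = 2
      rw [if_neg hgg₀, if_neg hge', if_neg hgout]
    have hsumX : ∑ k ∈ X, q k = 2 + (2 + (B.J₀.card + 1)) := by
      rw [hXdef, sum_insert hg_ins, sum_insert hg₀J, hsumJ, hqg, hqg₀]
    have hexp := hB X hXr
    rw [hXcard] at hexp
    rw [hsumX] at hbd
    -- `#F ≤ 2`, so `F = D e'`, `D e ⊆ D e'`, `D e = D e'`, `e = e'`
    have hF2 : F.card = 2 := by omega
    have hFeq : B.D e' = F := eq_of_subset_of_card_le hDe'F (by rw [hF2, hDe', card_pair h12])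
    have hDeF : B.D e ⊆ F := hW.hD e he
    have heD : e ∉ B.D e := fun h => (mem_sdiff.1 (hW.hD e he h)).2 he
    have h2De : 2 ≤ (B.D e).card := two_le_card_of_even I hI hS heD (hW.hDeven e he)
    have hDD : B.D e = B.D e' := by
      rw [hFeq]
      exact eq_of_subset_of_card_le hDeF (by rw [hF2]; exact h2De)
    have he'D : e' ∉ B.D e := fun h => (mem_sdiff.1 (hW.hD e he h)).2 he'
    have hev' : ∀ w, Even (xpdeg I (insert e' (B.D e)) w) := fun w => by rw [hDD]; exact hW.hDeven e' he' w
    exact hne (eq_of_fundamental_eq I hI hS heD he'D (hW.hDeven e he) hev').symm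

end Summit.PneNP.PneNP.Theorems.PstarGateU2BranchA
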